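import Mathlib
import Summits.NavierStokesRegularity.Statement
import Literature.Analysis.FluidPDE.ClassicalSolution
import Literature.Analysis.FluidPDE.LerayHopf
import Literature.Analysis.FluidPDE.NSWave0
import Literature.Analysis.FluidPDE.NSLerayHopf

/-!
# NavierStokesRegularity — route `Blowup` / `CertifiedBlowup`, rank-1 assembly

Settles `stmt-NavierStokesRegularity-0151` (positive): the formal glue
`(X5a ∧ X5b) → ¬ NavierStokesRegularity`, where

* `X5a` = finite-time blow-up of a maximal smooth Leray–Hopf solution from a rapidly decaying
  datum (`stmt-NavierStokesRegularity-0152`), and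
* `X5b` = uniqueness of Fefferman class-(A) solutions (jointly smooth on `ℝ³ × [0,∞)` with
  bounded energy) against the classical Leray–Hopf solution from the same datum on its interval
  of smooth existence (`stmt-NavierStokesRegularity-0153`).

Proof: apply (A) to the datum `u 0` of the blowing-up solution (smooth and divergence free as a
time slice of a classical solution, rapidly decaying by hypothesis) to get a global Clay-class
solution `(u', p')`; `X5b` identifies `u'` with `u` on `[0, T)`; the bridge
`Literature.Analysis.FluidPDE.isNavierStokesSolution_and_smooth_iff` makes `(u', p')` a classical solution on `Ici 0`,
whose restriction to `Ico 0 (T + 1)` is a smooth extension of `u` past `T`, contradicting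
maximality. No analysis; both conjuncts of the hypothesis are open.
-/

open Set

namespace Literature.NS

/-- Settles stmt-NavierStokesRegularity-0151: finite-time blow-up of a maximal smooth Leray–Hopf
solution from a rapidly decaying datum (`X5a`), together with uniqueness of Fefferman class-(A)
solutions against the classical Leray–Hopf solution on its interval of existence (`X5b`), refutes
Clay statement (A) `NavierStokesRegularity`. Pure assembly: (A) applied to the datum gives a global
smooth bounded-energy solution, `X5b` glues it to the blowing-up one on `[0, T)`, and its
restriction to `[0, T + 1)` is a smooth extension past `T`, contradicting maximality
(Beale–Kato–Majda 1984, §1, maximal interval of smooth existence). [folklore] -/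
theorem blowup_assembly :
    ((∃ ν : ℝ, 0 < ν ∧ ∃ T : ℝ, 0 < T ∧ ∃ (u : ℝ → EuclideanSpace ℝ (Fin 3) → EuclideanSpace ℝ (Fin 3)) (p : ℝ → EuclideanSpace ℝ (Fin 3) → ℝ),
        Literature.Analysis.FluidPDE.IsMaximalSmoothSolution ν 0 u p T ∧ Literature.Analysis.FluidPDE.IsLerayHopfOn T ν 0 (u 0) u ∧
          Literature.Analysis.FluidPDE.HasRapidSpatialDecay (u 0)) ∧
      (∀ ν : ℝ, 0 < ν → ∀ (u₀ : EuclideanSpace ℝ (Fin 3) → EuclideanSpace ℝ (Fin 3)), Literature.Analysis.FluidPDE.HasRapidSpatialDecay u₀ →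
        ∀ (u v : ℝ → EuclideanSpace ℝ (Fin 3) → EuclideanSpace ℝ (Fin 3)) (p q : ℝ → EuclideanSpace ℝ (Fin 3) → ℝ) (T : ℝ), 0 < T →
          Literature.Analysis.FluidPDE.IsSmoothOnHalfSpace u → Literature.Analysis.FluidPDE.IsSmoothOnHalfSpace p →
          Literature.Analysis.FluidPDE.IsNavierStokesSolution ν 0 u₀ u p → Literature.Analysis.FluidPDE.HasBoundedEnergy u →
          Literature.Analysis.FluidPDE.IsClassicalNSSolutionOn (Set.Ico 0 T) ν 0 v q →
          Literature.Analysis.FluidPDE.IsLerayHopfOn T ν 0 u₀ v → v 0 = u₀ → ∀ t ∈ Set.Ico 0 T, u t = v t)) →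
      ¬ NavierStokesRegularity := by
  rintro ⟨⟨ν, hν, T, hT, u, p, ⟨hcl, hmax⟩, hLH, hdec⟩, hX5b⟩ hA
  have h0 : (0 : ℝ) ∈ Set.Ico 0 T := ⟨le_rfl, hT⟩
  obtain ⟨u', p', hu', hp', hns, hbe⟩ :=
    hA ν hν (u 0) (hcl.contDiff_velocity h0) (hcl.divFree 0 h0) hdec
  have heq : ∀ t ∈ Set.Ico 0 T, u' t = u t :=
    hX5b ν hν (u 0) hdec u' u p' p T hT hu' hp' hns hbe hcl hLH rfl
  have hcl' : Literature.Analysis.FluidPDE.IsClassicalNSSolutionOn (Ici 0) ν 0 u' p' :=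
    (Literature.Analysis.FluidPDE.isNavierStokesSolution_and_smooth_iff.1 ⟨hns, hu', hp'⟩).1
  refine hmax ⟨T + 1, by linarith, u', p', ?_, heq⟩
  exact hcl'.mono (fun t ht => ht.1) (uniqueDiffOn_Ico 0 (T + 1))

end Literature.NS
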